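import Mathlib
import HarnessLib
import Literature.MathematicalPhysics.StatisticalMechanics.LennardJonesClusters
import Literature.MathematicalPhysics.StatisticalMechanics.TwoScaleShellSums
import Literature.MathematicalPhysics.StatisticalMechanics.MuGSC
import Summits.AtomisticToContinuum.Crystallization.Theorems.ChartedPlanarOrderWindowCounting

/-!
# The cross bound: the interaction of a hard-core ball with its exterior is of SURFACE order

decomp-a2c · N `stmt-AtomisticToContinuum-26636` · geometric half of the door input `BindingSurface`
(`ChartedPlanarOrderRigidityDoor.BindingSurface`, critic rows 381 (3) / 384 (2); the removal-test assembly is hand-2's).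
For a `δ`-separated `S ⊆ ℝ³`, `R ≥ 1`, atoms `K ⊆ S ∩ B̄(0,R)` and exterior atoms `F ⊆ S ∖ B̄(0,R)`:

  `Σ_{x ∈ K} Σ_{y ∈ F} |V_LJ(dist x y)| ≤ C₁(δ) · R²`      (`sum_sum_abs_lj_cross_le`, finite form)
  `Σ_{x ∈ K} Σ'_{y ∈ S ∖ B̄(0,R)} |V_LJ(dist x y)| ≤ C₁(δ) · R²`   (`sum_tsum_abs_lj_cross_le`, summed form)

with `C₁(δ) = A_δ · C_sh(δ) · (δ⁻³ + 2)`, `A_δ = (δ⁻⁶/12 + 1/6)·250·δ⁻³` (two-scale shell sum,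
`Literature…TwoScaleShellSums`), `C_sh(δ) = 24(1+δ/2)²(1+δ)/δ³ + (2/δ+1)³` (unit-shell count `card_shell_le` of
`ChartedPlanarOrderWindowCounting` + packing of the unit ball).  Proof: an atom at depth `t = R − ‖x‖` sees the exterior at
distance `≥ max(δ, t)`, so its exterior field is `≤ A_δ·max(δ,t)⁻³`; decompose `K` into unit shells `⌊R − ‖x‖⌋ = j`, each with
`≤ C_sh R²` atoms, and sum `Σ_j max(δ,j)⁻³ ≤ δ⁻³ + 2`.

Filed `--supports stmt-AtomisticToContinuum-26636` (helper, DEF-FREE; hand-1 g8).  [folklore]; axioms standard.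
-/

noncomputable section

namespace Summit.AtomisticToContinuum.Crystallization.Theorems.ChartedPlanarOrderCrossBound

open Metric Set
open Literature.MathematicalPhysics.StatisticalMechanics
open Summit.AtomisticToContinuum.Crystallization.Theorems.ChartedPlanarOrderWindowCounting (card_shell_le)

/-- `‖y‖ ≤ ‖x‖ + dist x y`. -/
private theorem norm_le_norm_add_dist (x y : EuclideanSpace ℝ (Fin 3)) : ‖y‖ ≤ ‖x‖ + dist x y := by
  calc ‖y‖ = ‖x - (x - y)‖ := by rw [sub_sub_cancel]
    _ ≤ ‖x‖ + ‖x - y‖ := norm_sub_le _ _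
    _ = ‖x‖ + dist x y := by rw [dist_eq_norm]

/-! ## Per-atom exterior field -/

/-- **exterior field of one atom**: for `x ∈ S` with `‖x‖ ≤ R` and a finite set `F` of atoms of `S` outside `B̄(0,R)`,
`Σ_{y∈F} |V(dist x y)| ≤ A_δ · max(δ, R − ‖x‖)⁻³`. [folklore] -/
theorem sum_abs_lj_exterior_le {δ : ℝ} (hδ : 0 < δ) {S : Set (EuclideanSpace ℝ (Fin 3))}
    (hsep : ∀ x ∈ S, ∀ y ∈ S, x ≠ y → δ ≤ dist x y) {x : EuclideanSpace ℝ (Fin 3)} (hx : x ∈ S)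
    {R : ℝ} (hxR : ‖x‖ ≤ R) (F : Finset (EuclideanSpace ℝ (Fin 3))) (hF : (↑F : Set _) ⊆ S \ closedBall 0 R) :
    ∑ y ∈ F, |lennardJones (dist x y)| ≤
      (δ⁻¹ ^ 6 / 12 + 1 / 6) * (250 * δ⁻¹ ^ 3 * (max δ (R - ‖x‖))⁻¹ ^ 3) := by
  refine sum_abs_lennardJones_le_two_scale F x hδ (le_max_left _ _) ?_ ?_
  · intro z hz w hw hzw
    exact hsep z (hF hz).1 w (hF hw).1 hzw
  · intro z hz
    have hzS : z ∈ S := (hF hz).1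
    have hzR : R < ‖z‖ := by
      have := (hF hz).2
      rw [mem_closedBall_zero_iff, not_le] at this
      exact this
    have hxz : x ≠ z := by
      rintro rfl; linarith
    refine max_le (hsep x hx z hzS hxz) ?_
    have := norm_le_norm_add_dist x z
    linarith

/-! ## Unit shells -/

/-- **unit-shell count**: among atoms `Kf ⊆ S ∩ B̄(0,R)` (`S` `δ`-separated, `R ≥ 1`), those at depth `⌊R − ‖x‖⌋ = j` number
`≤ C_sh(δ)·R²`, `C_sh(δ) = 24(1+δ/2)²(1+δ)/δ³ + (2/δ+1)³`. [folklore] -/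
theorem card_depth_fiber_le {δ : ℝ} (hδ : 0 < δ) {S : Set (EuclideanSpace ℝ (Fin 3))}
    (hsep : ∀ x ∈ S, ∀ y ∈ S, x ≠ y → δ ≤ dist x y) {R : ℝ} (hR : 1 ≤ R)
    (Kf : Finset (EuclideanSpace ℝ (Fin 3))) (hK : (↑Kf : Set _) ⊆ S ∩ closedBall 0 R) (j : ℕ) :
    ((Kf.filter fun x => ⌊R - ‖x‖⌋₊ = j).card : ℝ) ≤
      (24 * (1 + δ / 2) ^ 2 * (1 + δ) / δ ^ 3 + (2 / δ + 1) ^ 3) * R ^ 2 := by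
  classical
  set s := Kf.filter fun x => ⌊R - ‖x‖⌋₊ = j with hs
  have hsd : ∀ x ∈ s, ∀ y ∈ s, x ≠ y → δ ≤ dist x y := fun x hx y hy hxy =>
    hsep x (hK (Finset.mem_filter.mp hx).1).1 y (hK (Finset.mem_filter.mp hy).1).1 hxy
  have hband : ∀ x ∈ s, (j : ℝ) ≤ R - ‖x‖ ∧ R - ‖x‖ < j + 1 := by
    intro x hx
    obtain ⟨hxK, hxj⟩ := Finset.mem_filter.mp hx
    have hxR : ‖x‖ ≤ R := mem_closedBall_zero_iff.mp (hK hxK).2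
    exact (Nat.floor_eq_iff (by linarith)).mp hxj
  have hA : 0 ≤ 24 * (1 + δ / 2) ^ 2 * (1 + δ) / δ ^ 3 := by positivity
  have hB : 0 ≤ (2 / δ + 1) ^ 3 := by positivity
  have hR2 : 1 ≤ R ^ 2 := by nlinarith
  by_cases hj : 1 ≤ R - j
  · -- a genuine shell of radius `R - j ≥ 1`, thickness `1`
    have h1 := card_shell_le (r := 1) (R := R - j) hδ one_pos hj s
      (fun x hx => by
        rw [dist_zero_right]
        obtain ⟨h1, h2⟩ := hband x hx
        constructor <;> linarith) hsd
    have hRj : (R - j) ^ 2 ≤ R ^ 2 := by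
      have : (0 : ℝ) ≤ j := Nat.cast_nonneg j
      nlinarith
    calc (s.card : ℝ) ≤ 24 * (1 + δ / 2) ^ 2 * (1 + δ) / δ ^ 3 * (R - j) ^ 2 := h1
      _ ≤ 24 * (1 + δ / 2) ^ 2 * (1 + δ) / δ ^ 3 * R ^ 2 := mul_le_mul_of_nonneg_left hRj hA
      _ ≤ (24 * (1 + δ / 2) ^ 2 * (1 + δ) / δ ^ 3 + (2 / δ + 1) ^ 3) * R ^ 2 := by nlinarith
  · -- the shell lies inside the unit ball
    rw [not_le] at hj
    have h1 := card_le_of_separated_of_dist_le s (0 : EuclideanSpace ℝ (Fin 3)) hδ zero_le_one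
      (fun x hx => by
        rw [dist_zero_right]
        obtain ⟨h1, -⟩ := hband x hx
        linarith) hsd
    rw [finrank_euclideanSpace_fin] at h1
    calc (s.card : ℝ) ≤ (2 * 1 / δ + 1) ^ 3 := h1
      _ = (2 / δ + 1) ^ 3 := by ring
      _ ≤ (2 / δ + 1) ^ 3 * R ^ 2 := le_mul_of_one_le_right hB hR2
      _ ≤ (24 * (1 + δ / 2) ^ 2 * (1 + δ) / δ ^ 3 + (2 / δ + 1) ^ 3) * R ^ 2 := by nlinarith

/-- `Σ_{j ∈ u} max(δ, j)⁻³ ≤ δ⁻³ + 2` for any finite set of depths. [folklore] -/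
theorem sum_inv_max_cube_le {δ : ℝ} (hδ : 0 < δ) (u : Finset ℕ) :
    ∑ j ∈ u, (max δ (j : ℝ))⁻¹ ^ 3 ≤ δ⁻¹ ^ 3 + 2 := by
  classical
  have hsplit := (Finset.sum_filter_add_sum_filter_not u (fun j => j = 0) fun j => (max δ (j : ℝ))⁻¹ ^ 3)
  rw [← hsplit]
  have h0 : ∑ j ∈ u.filter (fun j => j = 0), (max δ (j : ℝ))⁻¹ ^ 3 ≤ δ⁻¹ ^ 3 := by
    have hsub : u.filter (fun j => j = 0) ⊆ {0} := fun j hj => by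
      rw [Finset.mem_singleton]; exact (Finset.mem_filter.mp hj).2
    calc ∑ j ∈ u.filter (fun j => j = 0), (max δ (j : ℝ))⁻¹ ^ 3
        ≤ ∑ j ∈ ({0} : Finset ℕ), (max δ (j : ℝ))⁻¹ ^ 3 :=
          Finset.sum_le_sum_of_subset_of_nonneg hsub fun j _ _ => by positivity
      _ = (max δ 0)⁻¹ ^ 3 := by simp
      _ = δ⁻¹ ^ 3 := by rw [max_eq_left hδ.le]
  have h1 : ∑ j ∈ u.filter (fun j => ¬ j = 0), (max δ (j : ℝ))⁻¹ ^ 3 ≤ 2 := by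
    set u' := u.filter (fun j => ¬ j = 0) with hu'
    have hpos : ∀ j ∈ u', 1 ≤ (j : ℝ) := fun j hj => by
      have := (Finset.mem_filter.mp hj).2
      exact_mod_cast Nat.one_le_iff_ne_zero.mpr this
    have hterm : ∀ j ∈ u', (max δ (j : ℝ))⁻¹ ^ 3 ≤ ((j : ℝ) ^ 2)⁻¹ := by
      intro j hj
      have hj1 := hpos j hj
      have hj0 : 0 < (j : ℝ) := by linarith
      have hle : (max δ (j : ℝ))⁻¹ ≤ (j : ℝ)⁻¹ := inv_anti₀ hj0 (le_max_right _ _)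
      have hinv1 : (j : ℝ)⁻¹ ≤ 1 := inv_le_one_of_one_le₀ hj1
      have hinv0 : 0 ≤ (max δ (j : ℝ))⁻¹ := inv_nonneg.mpr (hj0.le.trans (le_max_right _ _))
      calc (max δ (j : ℝ))⁻¹ ^ 3 ≤ ((j : ℝ)⁻¹) ^ 3 := pow_le_pow_left₀ hinv0 hle 3
        _ = ((j : ℝ)⁻¹) ^ 2 * (j : ℝ)⁻¹ := by ring
        _ ≤ ((j : ℝ)⁻¹) ^ 2 * 1 := mul_le_mul_of_nonneg_left hinv1 (by positivity)
        _ = ((j : ℝ) ^ 2)⁻¹ := by rw [mul_one, inv_pow]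
    have hsub : u' ⊆ Finset.Ioo 0 (u'.sup id + 1) := fun j hj => by
      rw [Finset.mem_Ioo]
      exact ⟨Nat.pos_of_ne_zero (Finset.mem_filter.mp hj).2, Nat.lt_succ_of_le (Finset.le_sup (f := id) hj)⟩
    have h2 := sum_Ioo_inv_sq_le (α := ℝ) 0 (u'.sup id + 1)
    calc ∑ j ∈ u', (max δ (j : ℝ))⁻¹ ^ 3 ≤ ∑ j ∈ u', ((j : ℝ) ^ 2)⁻¹ := Finset.sum_le_sum hterm
      _ ≤ ∑ j ∈ Finset.Ioo 0 (u'.sup id + 1), ((j : ℝ) ^ 2)⁻¹ :=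
          Finset.sum_le_sum_of_subset_of_nonneg hsub fun j _ _ => by positivity
      _ ≤ 2 := by simpa using h2
  linarith

/-! ## The cross bound -/

/-- **The cross bound (finite form).**  For every hard core `δ > 0` there is `C₁ ≥ 0` such that for every `δ`-separated `S`, every
`R ≥ 1`, all finite `Kf ⊆ S ∩ B̄(0,R)` and `F ⊆ S ∖ B̄(0,R)`: `Σ_{x∈Kf} Σ_{y∈F} |V_LJ(dist x y)| ≤ C₁ · R²`. [folklore] -/
theorem sum_sum_abs_lj_cross_le {δ : ℝ} (hδ : 0 < δ) :
    ∃ C₁ : ℝ, 0 ≤ C₁ ∧ ∀ S : Set (EuclideanSpace ℝ (Fin 3)), (∀ x ∈ S, ∀ y ∈ S, x ≠ y → δ ≤ dist x y) →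
      ∀ R : ℝ, 1 ≤ R → ∀ Kf F : Finset (EuclideanSpace ℝ (Fin 3)),
        (↑Kf : Set _) ⊆ S ∩ closedBall 0 R → (↑F : Set _) ⊆ S \ closedBall 0 R →
          ∑ x ∈ Kf, ∑ y ∈ F, |lennardJones (dist x y)| ≤ C₁ * R ^ 2 := by
  classical
  set A : ℝ := (δ⁻¹ ^ 6 / 12 + 1 / 6) * (250 * δ⁻¹ ^ 3) with hA
  set Csh : ℝ := 24 * (1 + δ / 2) ^ 2 * (1 + δ) / δ ^ 3 + (2 / δ + 1) ^ 3 with hCsh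
  have hA0 : 0 ≤ A := by positivity
  have hCsh0 : 0 ≤ Csh := by positivity
  refine ⟨A * Csh * (δ⁻¹ ^ 3 + 2), by positivity, fun S hsep R hR Kf F hK hF => ?_⟩
  set g : EuclideanSpace ℝ (Fin 3) → ℕ := fun x => ⌊R - ‖x‖⌋₊ with hg
  -- per-atom bound, monotone in the depth shell
  have hatom : ∀ x ∈ Kf, ∑ y ∈ F, |lennardJones (dist x y)| ≤ A * (max δ (g x : ℝ))⁻¹ ^ 3 := by
    intro x hx
    have hxS : x ∈ S := (hK hx).1
    have hxR : ‖x‖ ≤ R := mem_closedBall_zero_iff.mp (hK hx).2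
    have h1 := sum_abs_lj_exterior_le hδ hsep hxS hxR F hF
    have hgx : (g x : ℝ) ≤ R - ‖x‖ := Nat.floor_le (by linarith)
    have hmax : max δ (g x : ℝ) ≤ max δ (R - ‖x‖) := max_le_max le_rfl hgx
    have hpos : 0 < max δ (g x : ℝ) := lt_max_of_lt_left hδ
    have hinv : (max δ (R - ‖x‖))⁻¹ ^ 3 ≤ (max δ (g x : ℝ))⁻¹ ^ 3 :=
      pow_le_pow_left₀ (inv_nonneg.mpr (hpos.le.trans hmax)) (inv_anti₀ hpos hmax) 3
    calc ∑ y ∈ F, |lennardJones (dist x y)| ≤ (δ⁻¹ ^ 6 / 12 + 1 / 6) * (250 * δ⁻¹ ^ 3 * (max δ (R - ‖x‖))⁻¹ ^ 3) := h1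
      _ = A * (max δ (R - ‖x‖))⁻¹ ^ 3 := by rw [hA]; ring
      _ ≤ A * (max δ (g x : ℝ))⁻¹ ^ 3 := mul_le_mul_of_nonneg_left hinv hA0
  -- regroup by depth shells
  have hmaps : ∀ x ∈ Kf, g x ∈ Kf.image g := fun x hx => Finset.mem_image_of_mem g hx
  have hfib := Finset.sum_fiberwise_of_maps_to hmaps (fun x => A * (max δ (g x : ℝ))⁻¹ ^ 3)
  have hshell : ∀ j ∈ Kf.image g,
      ∑ x ∈ Kf.filter (fun x => g x = j), A * (max δ (g x : ℝ))⁻¹ ^ 3 ≤ Csh * R ^ 2 * (A * (max δ (j : ℝ))⁻¹ ^ 3) := by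
    intro j _
    have hconst : ∑ x ∈ Kf.filter (fun x => g x = j), A * (max δ (g x : ℝ))⁻¹ ^ 3 =
        ((Kf.filter fun x => g x = j).card : ℝ) * (A * (max δ (j : ℝ))⁻¹ ^ 3) := by
      rw [Finset.sum_congr rfl fun x hx => by rw [(Finset.mem_filter.mp hx).2], Finset.sum_const, nsmul_eq_mul]
    rw [hconst]
    exact mul_le_mul_of_nonneg_right (card_depth_fiber_le hδ hsep hR Kf hK j) (by positivity)
  calc ∑ x ∈ Kf, ∑ y ∈ F, |lennardJones (dist x y)|
      ≤ ∑ x ∈ Kf, A * (max δ (g x : ℝ))⁻¹ ^ 3 := Finset.sum_le_sum hatom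
    _ = ∑ j ∈ Kf.image g, ∑ x ∈ Kf.filter (fun x => g x = j), A * (max δ (g x : ℝ))⁻¹ ^ 3 := hfib.symm
    _ ≤ ∑ j ∈ Kf.image g, Csh * R ^ 2 * (A * (max δ (j : ℝ))⁻¹ ^ 3) := Finset.sum_le_sum hshell
    _ = Csh * R ^ 2 * A * ∑ j ∈ Kf.image g, (max δ (j : ℝ))⁻¹ ^ 3 := by
        rw [Finset.mul_sum]; refine Finset.sum_congr rfl fun j _ => by ring
    _ ≤ Csh * R ^ 2 * A * (δ⁻¹ ^ 3 + 2) :=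
        mul_le_mul_of_nonneg_left (sum_inv_max_cube_le hδ _) (by positivity)
    _ = A * Csh * (δ⁻¹ ^ 3 + 2) * R ^ 2 := by ring

/-- **The cross bound (summed form).**  Same constant: for every `δ`-separated `S`, `R ≥ 1` and finite `Kf ⊆ S ∩ B̄(0,R)`,
`Σ_{x∈Kf} Σ'_{y ∈ S ∖ B̄(0,R)} |V_LJ(dist x y)| ≤ C₁ · R²` (the inner series converge by the hard core). [folklore] -/
theorem sum_tsum_abs_lj_cross_le {δ : ℝ} (hδ : 0 < δ) :
    ∃ C₁ : ℝ, 0 ≤ C₁ ∧ ∀ S : Set (EuclideanSpace ℝ (Fin 3)), (∀ x ∈ S, ∀ y ∈ S, x ≠ y → δ ≤ dist x y) →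
      ∀ R : ℝ, 1 ≤ R → ∀ Kf : Finset (EuclideanSpace ℝ (Fin 3)), (↑Kf : Set _) ⊆ S ∩ closedBall 0 R →
        ∑ x ∈ Kf, ∑' y : ↥(S \ closedBall 0 R), |lennardJones (dist x (y : EuclideanSpace ℝ (Fin 3)))| ≤ C₁ * R ^ 2 := by
  classical
  obtain ⟨C₁, hC₁, h⟩ := sum_sum_abs_lj_cross_le hδ
  refine ⟨C₁, hC₁, fun S hsep R hR Kf hK => ?_⟩
  set T : Set (EuclideanSpace ℝ (Fin 3)) := S \ closedBall 0 R with hT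
  have hTS : T ⊆ S := fun y hy => hy.1
  have hTud : UniformlyDiscrete T := ⟨δ, hδ, fun a ha b hb hab => hsep a (hTS ha) b (hTS hb) hab⟩
  have hsum : ∀ x : EuclideanSpace ℝ (Fin 3), Summable fun y : ↥T => |lennardJones (dist x (y : EuclideanSpace ℝ (Fin 3)))| :=
    fun x => (hTud.summable_lennardJones x).abs
  rw [← Summable.tsum_finsetSum (fun x _ => hsum x)]
  refine (summable_sum fun x _ => hsum x).tsum_le_of_sum_le fun u => ?_
  rw [Finset.sum_comm]
  set F : Finset (EuclideanSpace ℝ (Fin 3)) := u.image Subtype.val with hF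
  have hFT : (↑F : Set _) ⊆ T := by
    intro y hy
    rw [Finset.mem_coe, hF, Finset.mem_image] at hy
    obtain ⟨w, -, rfl⟩ := hy
    exact w.2
  have hrew : ∀ x : EuclideanSpace ℝ (Fin 3),
      ∑ y ∈ u, |lennardJones (dist x (y : EuclideanSpace ℝ (Fin 3)))| = ∑ y ∈ F, |lennardJones (dist x y)| := by
    intro x
    rw [hF, Finset.sum_image (fun a _ b _ hab => Subtype.ext hab)]
  rw [Finset.sum_congr rfl fun x _ => hrew x]
  exact h S hsep R hR Kf F hK hFT

end Summit.AtomisticToContinuum.Crystallization.Theorems.ChartedPlanarOrderCrossBound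

end
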